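import Summits.NavierStokesRegularity.NavierStokesRegularity.Theses.RellichScar
import Summits.NavierStokesRegularity.NavierStokesRegularity.Theorems.SymmetricScarExists.Negative.SpiralWorld
import Summits.NavierStokesRegularity.NavierStokesRegularity.Theorems.SymmetricScarExists.Negative.RdssWall
import Summits.NavierStokesRegularity.NavierStokesRegularity.Theorems.RellichScarScarRigidityApexMild
import Summits.NavierStokesRegularity.NavierStokesRegularity.Theorems.RellichScarScarRigidityFarFieldAllOrders
import Summits.NavierStokesRegularity.NavierStokesRegularity.Theorems.RellichScarNoMildScarZoom
import Summits.NavierStokesRegularity.NavierStokesRegularity.Theorems.RellichScarSymmetricScarExistsScarDefectLimitLemmas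
import Literature.Analysis.FluidPDE.TypeIAncientMild
import Literature.Analysis.FluidPDE.LocalTypeI
import Literature.Analysis.FluidPDE.BoundedWeakIsometry

/-!
# `SymmetricScarExists`, line `analytic-scar-window-rigidity` — stub `stub_scarDefectLimit`
# (crux stmt-NavierStokesRegularity-11718, route RellichScar)

**Scar defects pass to `L³_loc` limits of apex profiles.**  Let `w j → u` in `L³(Q(0,R))` for
every `R > 0` be apex Type-I profiles (suitable weak solutions on the backward slab with `𝐈 < ∞`
and the apex bound `‖w‖ ≤ C/(‖x‖ + √−t)`, one constant `C > 0`).  If for a fixed scale `λ > 0` the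
defect `‖(w j)_λ − w j‖_{L^∞((−δ,0)×K)}` (`u_λ = nsRescale λ u`) is eventually (in `j`) at most `ε`
for all small `δ`, for every compact `K ∌ 0` and every `ε > 0`, then the limit has a
`λ`-homogeneous scar, `SameScar (nsRescale λ u) u`; likewise for the rotation-conjugates
`conjZ θ`.  The statement is conditional on the statements of the two neighbouring stubs of the
line (its first two hypotheses): (B1) every Type-I ancient mild field with the apex bound has a
static trace (SCAR) `σ` with the uniform cubic rate `‖V(t,x) − σ(x)‖ ≤ L(−t)/‖x‖³`, `L = L(C)`;
(B2) `L³_loc` convergence of such fields is pointwise convergence on `t < 0`.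

Proof.  Replace `w j`, `u` by their classical representatives `W j`, `U`
(`RellichScarScarRigidity.stub_apexMildRepresentative`); all functionals in sight only see the
slab up to null sets, and the parabolic dilation / the rotation preserve null sets of the slab
(`nsRescale_ae_eq_slab`, `conjZ_ae_eq_slab`).  By (B1) they have scars `σ j`, `σU` with one rate
`L`; by (B2) `W j → U` pointwise, hence `σ j → σU` pointwise off the origin
(`tendsto_static_of_tendsto`).  The abstract defect-limit lemma `sameScar_of_flat_defect` of the
companion file `RellichScarSymmetricScarExistsScarDefectLimitLemmas.lean` (esssup = sup for
continuous fields on open boxes, `t ↑ 0`, `j → ∞`, then the cubic rate of `T U − U`) applies to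
`T = nsRescale λ` with `T' σ = λσ(λ·)` and to `T = conjZ θ` with `T' σ = R_θ σ(R_{−θ}·)`: both
preserve continuity on the open slab, transport the cubic rate, and `T'` is continuous for
pointwise convergence (this file, §1).

References: G. Koch, N. Nadirashvili, G. Seregin, V. Šverák, Acta Math. 203 (2009), §4 and (1.6)
(classical representatives, scale and rotation invariance) [KochNadirashviliSereginSverak2009];
D. Albritton, T. Barker, arXiv:1811.00502, §3 (zooms of suitable weak solutions)
[AlbrittonBarker2019].
-/

noncomputable section

open MeasureTheory Set Function Filter Topology TopologicalSpace Metric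
open scoped NNReal ENNReal

namespace Summit.NavierStokesRegularity.NavierStokesRegularity.Theorems.SymmetricScarExists.ScarWindow

open Literature.Analysis.FluidPDE
open Summit.NavierStokesRegularity.NavierStokesRegularity.Theses.RellichScar
open Summit.NavierStokesRegularity.NavierStokesRegularity.Theorems.SymmetricScarExists.Negative

set_option linter.dupNamespace false

/-! ## §1 The two symmetry operations: null sets, continuity, rates -/

/-- Rotations about the axis have trivial kernel: `R_θ x ≠ 0` for `x ≠ 0`. [folklore] -/
theorem rotZ_ne_zero (θ : ℝ) {x : EuclideanSpace ℝ (Fin 3)} (hx : x ≠ 0) : rotZ θ x ≠ 0 :=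
  fun h0 => by
  have h := norm_rotZ θ x
  rw [h0, norm_zero] at h
  exact hx (norm_eq_zero.1 h.symm)

/-- The parabolic rescaling about the origin respects a.e. equality on the slab (the dilation
`(t,x) ↦ (c²t, cx)` maps the slab onto itself and Lebesgue measure to a multiple of itself).
[folklore] -/
theorem nsRescale_ae_eq_slab {V v : ℝ → EuclideanSpace ℝ (Fin 3) → EuclideanSpace ℝ (Fin 3)}
    {c : ℝ} (hc : 0 < c)
    (h : uncurry V =ᵐ[volume.restrict (Iio (0 : ℝ) ×ˢ (univ : Set (EuclideanSpace ℝ (Fin 3))))]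
      uncurry v) :
    uncurry (nsRescale c V)
      =ᵐ[volume.restrict (Iio (0 : ℝ) ×ˢ (univ : Set (EuclideanSpace ℝ (Fin 3))))]
      uncurry (nsRescale c v) := by
  have hc2 : 0 < c ^ 2 := by positivity
  have hpre : stAffine (c ^ 2) c 0 (0 : EuclideanSpace ℝ (Fin 3)) ⁻¹'
      (Iio (0 : ℝ) ×ˢ (univ : Set (EuclideanSpace ℝ (Fin 3)))) = Iio (0 : ℝ) ×ˢ univ := by
    ext ⟨s, y⟩
    simp only [mem_preimage, stAffine_apply, zero_add, mem_prod, mem_Iio, mem_univ, and_true]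
    constructor
    · intro h
      by_contra hs
      push Not at hs
      have : 0 ≤ c ^ 2 * s := mul_nonneg hc2.le hs
      linarith
    · intro h
      exact mul_neg_of_pos_of_neg hc2 h
  have h1 := ae_restrict_preimage_stAffine hc2 hc 0 (0 : EuclideanSpace ℝ (Fin 3))
    (P := fun z => uncurry V z = uncurry v z) h
  rw [hpre] at h1
  filter_upwards [h1] with z hz
  have hz' : V (c ^ 2 * z.1) (c • z.2) = v (c ^ 2 * z.1) (c • z.2) := by
    simpa only [uncurry, stAffine, zero_add] using hz
  show c • V (c ^ 2 * z.1) (c • z.2) = c • v (c ^ 2 * z.1) (c • z.2)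
  rw [hz']

/-- The rotation-conjugation respects a.e. equality on the slab (`(t,x) ↦ (t, R_{−θ}x)` preserves
Lebesgue measure and the slab). [folklore] -/
theorem conjZ_ae_eq_slab {V v : ℝ → EuclideanSpace ℝ (Fin 3) → EuclideanSpace ℝ (Fin 3)} (θ : ℝ)
    (h : uncurry V =ᵐ[volume.restrict (Iio (0 : ℝ) ×ˢ (univ : Set (EuclideanSpace ℝ (Fin 3))))]
      uncurry v) :
    uncurry (conjZ θ V)
      =ᵐ[volume.restrict (Iio (0 : ℝ) ×ˢ (univ : Set (EuclideanSpace ℝ (Fin 3))))]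
      uncurry (conjZ θ v) := by
  have he := measurePreserving_prodMap_linearIsometryEquiv_slab (rotZIso (-θ)) (Iio (0 : ℝ))
    measurableSet_Iio
  have h2 := he.quasiMeasurePreserving.ae_eq_comp h
  filter_upwards [h2] with z hz
  have hz' : V z.1 (rotZ (-θ) z.2) = v z.1 (rotZ (-θ) z.2) := by
    simpa only [comp_apply, uncurry, Prod.map_fst, Prod.map_snd, id, rotZIso_apply] using hz
  show rotZ θ (V z.1 (rotZ (-θ) z.2)) = rotZ θ (v z.1 (rotZ (-θ) z.2))
  rw [hz']

/-- The rescaling of a field continuous on the open slab is continuous on the open slab.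
[folklore] -/
theorem continuousOn_uncurry_nsRescale {V : ℝ → EuclideanSpace ℝ (Fin 3) → EuclideanSpace ℝ (Fin 3)}
    {c : ℝ} (hc : 0 < c)
    (hV : ContinuousOn (uncurry V) (Iio (0 : ℝ) ×ˢ (univ : Set (EuclideanSpace ℝ (Fin 3))))) :
    ContinuousOn (uncurry (nsRescale c V))
      (Iio (0 : ℝ) ×ˢ (univ : Set (EuclideanSpace ℝ (Fin 3)))) := by
  have hmaps : MapsTo (stAffine (c ^ 2) c 0 (0 : EuclideanSpace ℝ (Fin 3)))
      (Iio (0 : ℝ) ×ˢ (univ : Set (EuclideanSpace ℝ (Fin 3))))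
      (Iio (0 : ℝ) ×ˢ (univ : Set (EuclideanSpace ℝ (Fin 3)))) := by
    rintro ⟨s, y⟩ ⟨hs, -⟩
    refine ⟨?_, mem_univ _⟩
    simp only [stAffine_apply, zero_add, mem_Iio] at hs ⊢
    exact mul_neg_of_pos_of_neg (by positivity) hs
  have h1 : ContinuousOn (fun z : ℝ × EuclideanSpace ℝ (Fin 3) =>
      c • uncurry V (stAffine (c ^ 2) c 0 (0 : EuclideanSpace ℝ (Fin 3)) z))
      (Iio (0 : ℝ) ×ˢ (univ : Set (EuclideanSpace ℝ (Fin 3)))) :=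
    (hV.comp (continuous_stAffine _ _ _ _).continuousOn hmaps).const_smul c
  refine h1.congr fun z _ => ?_
  simp only [uncurry, nsRescale_apply, stAffine, zero_add]

/-- The rotation-conjugate of a field continuous on the open slab is continuous there.
[folklore] -/
theorem continuousOn_uncurry_conjZ {V : ℝ → EuclideanSpace ℝ (Fin 3) → EuclideanSpace ℝ (Fin 3)}
    (θ : ℝ)
    (hV : ContinuousOn (uncurry V) (Iio (0 : ℝ) ×ˢ (univ : Set (EuclideanSpace ℝ (Fin 3))))) :
    ContinuousOn (uncurry (conjZ θ V)) (Iio (0 : ℝ) ×ˢ (univ : Set (EuclideanSpace ℝ (Fin 3)))) := by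
  have hmaps : MapsTo (Prod.map (id : ℝ → ℝ)
      (rotZIso (-θ) : EuclideanSpace ℝ (Fin 3) → EuclideanSpace ℝ (Fin 3)))
      (Iio (0 : ℝ) ×ˢ (univ : Set (EuclideanSpace ℝ (Fin 3))))
      (Iio (0 : ℝ) ×ˢ (univ : Set (EuclideanSpace ℝ (Fin 3)))) := by
    rintro ⟨s, y⟩ ⟨hs, -⟩
    exact ⟨hs, mem_univ _⟩
  have h1 : ContinuousOn (fun z : ℝ × EuclideanSpace ℝ (Fin 3) => rotZIso θ (uncurry V
      (Prod.map (id : ℝ → ℝ) (rotZIso (-θ) : EuclideanSpace ℝ (Fin 3) → EuclideanSpace ℝ (Fin 3)) z)))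
      (Iio (0 : ℝ) ×ˢ (univ : Set (EuclideanSpace ℝ (Fin 3)))) :=
    (rotZIso θ).continuous.comp_continuousOn
      (hV.comp (continuous_id.prodMap (rotZIso (-θ)).continuous).continuousOn hmaps)
  refine h1.congr fun z _ => ?_
  simp only [uncurry, conjZ, Prod.map_fst, Prod.map_snd, id, rotZIso_apply]

/-- The cubic trace rate is invariant under the parabolic rescaling: the rescaled field has the
rescaled trace `x ↦ c σ(cx)` at the same rate. [folklore] -/
theorem rate_nsRescale {V : ℝ → EuclideanSpace ℝ (Fin 3) → EuclideanSpace ℝ (Fin 3)}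
    {σ : EuclideanSpace ℝ (Fin 3) → EuclideanSpace ℝ (Fin 3)} {L c : ℝ} (hc : 0 < c)
    (h : ∀ t < (0 : ℝ), ∀ x : EuclideanSpace ℝ (Fin 3), x ≠ 0 →
      ‖V t x - σ x‖ ≤ L * (-t) / ‖x‖ ^ 3) :
    ∀ t < (0 : ℝ), ∀ x : EuclideanSpace ℝ (Fin 3), x ≠ 0 →
      ‖nsRescale c V t x - c • σ (c • x)‖ ≤ L * (-t) / ‖x‖ ^ 3 := by
  intro t ht x hx
  have hxpos : 0 < ‖x‖ := norm_pos_iff.2 hx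
  have hct : c ^ 2 * t < 0 := mul_neg_of_pos_of_neg (by positivity) ht
  have key := h (c ^ 2 * t) hct (c • x) (smul_ne_zero hc.ne' hx)
  rw [norm_smul, Real.norm_of_nonneg hc.le] at key
  rw [nsRescale_apply, ← smul_sub, norm_smul, Real.norm_of_nonneg hc.le]
  calc c * ‖V (c ^ 2 * t) (c • x) - σ (c • x)‖ ≤ c * (L * (-(c ^ 2 * t)) / (c * ‖x‖) ^ 3) :=
        mul_le_mul_of_nonneg_left key hc.le
    _ = L * (-t) / ‖x‖ ^ 3 := by
        field_simp

/-- The cubic trace rate is invariant under the rotation-conjugation: the conjugate field has the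
conjugate trace `x ↦ R_θ σ(R_{−θ}x)` at the same rate (`R_θ` is a linear isometry). [folklore] -/
theorem rate_conjZ {V : ℝ → EuclideanSpace ℝ (Fin 3) → EuclideanSpace ℝ (Fin 3)}
    {σ : EuclideanSpace ℝ (Fin 3) → EuclideanSpace ℝ (Fin 3)} {L : ℝ} (θ : ℝ)
    (h : ∀ t < (0 : ℝ), ∀ x : EuclideanSpace ℝ (Fin 3), x ≠ 0 →
      ‖V t x - σ x‖ ≤ L * (-t) / ‖x‖ ^ 3) :
    ∀ t < (0 : ℝ), ∀ x : EuclideanSpace ℝ (Fin 3), x ≠ 0 →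
      ‖conjZ θ V t x - rotZ θ (σ (rotZ (-θ) x))‖ ≤ L * (-t) / ‖x‖ ^ 3 := by
  intro t ht x hx
  have key := h t ht (rotZ (-θ) x) (rotZ_ne_zero (-θ) hx)
  rw [norm_rotZ] at key
  have e : conjZ θ V t x - rotZ θ (σ (rotZ (-θ) x)) =
      rotZIso θ (V t (rotZ (-θ) x) - σ (rotZ (-θ) x)) := by
    rw [map_sub]
    rfl
  rw [e, LinearIsometryEquiv.norm_map]
  exact key

/-! ## §2 The stub -/

/-- **Stub `stub_scarDefectLimit` (line `analytic-scar-window-rigidity`, crux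
`SymmetricScarExists`).**  Along an `L³(Q(0,R))`-convergent (every `R > 0`) sequence of apex
profiles with one decay constant `C > 0`, smallness of the scale-`λ` scar defect on every compact
`K ∌ 0` (essentially near the final slice, eventually along the sequence) passes to the limit as
`SameScar (nsRescale λ u) u`; likewise for the rotation-conjugates `conjZ θ`.  Conditional on the
statements of the neighbouring stubs `stub_apexScarTrace` (first hypothesis: scars with a uniform
cubic rate) and `stub_limitRepresentative` (second hypothesis: `L³_loc` convergence of Type-I
ancient mild fields is pointwise convergence); mechanism: classical representatives
(`RellichScarScarRigidity.stub_apexMildRepresentative`), pointwise convergence of the scars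
(`tendsto_static_of_tendsto`), `esssup = sup` for continuous fields on open boxes
(`sameScar_of_flat_defect`). [folklore] -/
theorem stub_scarDefectLimit :
    (∀ C : ℝ, 0 < C → ∃ L : ℝ, 0 ≤ L ∧ ∀ V : ℝ → EuclideanSpace ℝ (Fin 3) → EuclideanSpace ℝ (Fin 3), IsTypeIAncientMild C V → HasTypeIDecay C V →
      ∃ σ : EuclideanSpace ℝ (Fin 3) → EuclideanSpace ℝ (Fin 3),
        (∀ t : ℝ, t < 0 → ∀ x : EuclideanSpace ℝ (Fin 3), x ≠ 0 → ‖V t x - σ x‖ ≤ L * (-t) / ‖x‖ ^ 3) ∧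
        (∀ x : EuclideanSpace ℝ (Fin 3), x ≠ 0 → ‖σ x‖ ≤ C / ‖x‖) ∧
        (∀ x y : EuclideanSpace ℝ (Fin 3), x ≠ 0 → dist y x ≤ ‖x‖ / 2 → ‖σ y - σ x‖ ≤ L / ‖x‖ ^ 2 * dist y x)) →
    (∀ C : ℝ, 0 < C → ∀ (V : ℕ → ℝ → EuclideanSpace ℝ (Fin 3) → EuclideanSpace ℝ (Fin 3)) (W : ℝ → EuclideanSpace ℝ (Fin 3) → EuclideanSpace ℝ (Fin 3)),
      (∀ j : ℕ, IsTypeIAncientMild C (V j) ∧ HasTypeIDecay C (V j)) → IsTypeIAncientMild C W → HasTypeIDecay C W →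
      (∀ R : ℝ, 0 < R → Tendsto (fun j => eLpNorm (uncurry (V j) - uncurry W) 3 (volume.restrict (parabolicCylinder R (0 : ℝ × EuclideanSpace ℝ (Fin 3))))) atTop (𝓝 0)) →
      ∀ t : ℝ, t < 0 → ∀ x : EuclideanSpace ℝ (Fin 3), Tendsto (fun j => V j t x) atTop (𝓝 (W t x))) →
    ∀ (C : ℝ) (w : ℕ → ℝ → EuclideanSpace ℝ (Fin 3) → EuclideanSpace ℝ (Fin 3)) (qw : ℕ → ℝ → EuclideanSpace ℝ (Fin 3) → ℝ) (Hw : ℕ → ℝ → EuclideanSpace ℝ (Fin 3) → EuclideanSpace ℝ (Fin 3) →L[ℝ] EuclideanSpace ℝ (Fin 3)) (u : ℝ → EuclideanSpace ℝ (Fin 3) → EuclideanSpace ℝ (Fin 3)) (p : ℝ → EuclideanSpace ℝ (Fin 3) → ℝ) (G : ℝ → EuclideanSpace ℝ (Fin 3) → EuclideanSpace ℝ (Fin 3) →L[ℝ] EuclideanSpace ℝ (Fin 3)),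
      0 < C →
      (∀ j : ℕ, IsSuitableWeakSolutionOn (slab (EuclideanSpace ℝ (Fin 3)) (Iio (0 : ℝ)) isOpen_Iio) 1 0 (w j) (qw j) ∧ HasWeakSpatialGradientOn (slab (EuclideanSpace ℝ (Fin 3)) (Iio (0 : ℝ)) isOpen_Iio) (w j) (Hw j) ∧ typeIBound (Iio (0 : ℝ) ×ˢ univ) (w j) (qw j) (Hw j) < ⊤ ∧ HasTypeIDecay C (w j)) →
      IsSuitableWeakSolutionOn (slab (EuclideanSpace ℝ (Fin 3)) (Iio (0 : ℝ)) isOpen_Iio) 1 0 u p → HasWeakSpatialGradientOn (slab (EuclideanSpace ℝ (Fin 3)) (Iio (0 : ℝ)) isOpen_Iio) u G → typeIBound (Iio (0 : ℝ) ×ˢ univ) u p G < ⊤ → HasTypeIDecay C u →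
      (∀ R : ℝ, 0 < R → Tendsto (fun j => eLpNorm (uncurry (w j) - uncurry u) 3 (volume.restrict (parabolicCylinder R (0 : ℝ × EuclideanSpace ℝ (Fin 3))))) atTop (𝓝 0)) →
      (∀ lam : ℝ, 0 < lam →
        (∀ K : Set (EuclideanSpace ℝ (Fin 3)), IsCompact K → (0 : EuclideanSpace ℝ (Fin 3)) ∉ K → ∀ ε : ℝ, 0 < ε → ∀ᶠ j in atTop, ∀ᶠ δ in 𝓝[>] (0 : ℝ), eLpNorm (uncurry (nsRescale lam (w j)) - uncurry (w j)) ⊤ (volume.restrict (Ioo (-δ) 0 ×ˢ K)) ≤ ENNReal.ofReal ε) →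
        SameScar (nsRescale lam u) u) ∧
      (∀ θ : ℝ,
        (∀ K : Set (EuclideanSpace ℝ (Fin 3)), IsCompact K → (0 : EuclideanSpace ℝ (Fin 3)) ∉ K → ∀ ε : ℝ, 0 < ε → ∀ᶠ j in atTop, ∀ᶠ δ in 𝓝[>] (0 : ℝ), eLpNorm (uncurry (conjZ θ (w j)) - uncurry (w j)) ⊤ (volume.restrict (Ioo (-δ) 0 ×ˢ K)) ≤ ENNReal.ofReal ε) →
        SameScar (conjZ θ u) u) := by
  intro hB1 hB2 C w qw Hw u p G hC hw hsu hwg hIu hdu hconv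
  -- Step 0: classical representatives (a.e. equal on the slab) and their scars
  obtain ⟨L, hL, hB1C⟩ := hB1 C hC
  choose W hWae hWmild hWdec using fun j =>
    RellichScarScarRigidity.stub_apexMildRepresentative (w j) (qw j) (Hw j) C hC (hw j).1
      (hw j).2.1 (hw j).2.2.1 (hw j).2.2.2
  obtain ⟨U, hUae, hUmild, hUdec⟩ :=
    RellichScarScarRigidity.stub_apexMildRepresentative u p G C hC hsu hwg hIu hdu
  choose σ hσ using fun j => hB1C (W j) (hWmild j) (hWdec j)
  obtain ⟨σU, hUrate, -, -⟩ := hB1C U hUmild hUdec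
  have hWcont : ∀ j, ContinuousOn (uncurry (W j))
      (Iio (0 : ℝ) ×ˢ (univ : Set (EuclideanSpace ℝ (Fin 3)))) :=
    fun j => (hWmild j).1.continuousOn
  -- Step 1: `L³_loc` convergence of the representatives, pointwise convergence (B2), of the scars
  have hconvW : ∀ R : ℝ, 0 < R → Tendsto (fun j => eLpNorm (uncurry (W j) - uncurry U) 3
      (volume.restrict (parabolicCylinder R (0 : ℝ × EuclideanSpace ℝ (Fin 3))))) atTop (𝓝 0) := by
    intro R hR
    refine (hconv R hR).congr fun j => eLpNorm_congr_ae ?_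
    have hsub : parabolicCylinder R (0 : ℝ × EuclideanSpace ℝ (Fin 3)) ⊆
        Iio (0 : ℝ) ×ˢ (univ : Set (EuclideanSpace ℝ (Fin 3))) :=
      parabolicCylinder_origin_subset_slab R
    have h1 : uncurry (W j)
        =ᵐ[volume.restrict (parabolicCylinder R (0 : ℝ × EuclideanSpace ℝ (Fin 3)))]
        uncurry (w j) := ae_restrict_of_ae_restrict_of_subset hsub (hWae j)
    have h2 : uncurry U
        =ᵐ[volume.restrict (parabolicCylinder R (0 : ℝ × EuclideanSpace ℝ (Fin 3)))]
        uncurry u := ae_restrict_of_ae_restrict_of_subset hsub hUae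
    exact (h1.sub h2).symm
  have hpt : ∀ t < (0 : ℝ), ∀ x : EuclideanSpace ℝ (Fin 3),
      Tendsto (fun j => W j t x) atTop (𝓝 (U t x)) :=
    hB2 C hC W U (fun j => ⟨hWmild j, hWdec j⟩) hUmild hUdec hconvW
  have hσlim : ∀ x : EuclideanSpace ℝ (Fin 3), x ≠ 0 →
      Tendsto (fun j => σ j x) atTop (𝓝 (σU x)) := fun x hx =>
    tendsto_static_of_tendsto (fun j => (hσ j).1) hUrate hpt hx
  refine ⟨fun lam hlam Hlam => ?_, fun θ Hθ => ?_⟩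
  · -- Step 2: the scale case, on the representatives, then back to `u`
    have hflat : ∀ K : Set (EuclideanSpace ℝ (Fin 3)), IsCompact K →
        (0 : EuclideanSpace ℝ (Fin 3)) ∉ K → ∀ ε : ℝ, 0 < ε → ∀ᶠ j in atTop,
        ∀ᶠ δ in 𝓝[>] (0 : ℝ), eLpNorm (uncurry (nsRescale lam (W j)) - uncurry (W j)) ⊤
          (volume.restrict (Ioo (-δ) 0 ×ˢ K)) ≤ ENNReal.ofReal ε := by
      intro K hK h0 ε hε
      filter_upwards [Hlam K hK h0 ε hε] with j hj
      filter_upwards [hj] with δ hδ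
      rwa [eLpNorm_scar_congr_ae (nsRescale_ae_eq_slab hlam (hWae j).symm) (hWae j).symm] at hδ
    have hS : SameScar (nsRescale lam U) U :=
      sameScar_of_flat_defect (nsRescale lam) (fun s x => lam • s (lam • x)) L W U σ σU hL
        (fun V hV => continuousOn_uncurry_nsRescale hlam hV)
        (fun V s hVs => rate_nsRescale hlam hVs)
        (fun s sl hs x hx => (hs (lam • x) (smul_ne_zero hlam.ne' hx)).const_smul lam)
        hWcont (fun j => (hσ j).1) hUrate hσlim hflat
    exact (sameScar_congr_ae (nsRescale_ae_eq_slab hlam hUae) hUae).1 hS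
  · -- Step 3: the rotation case, on the representatives, then back to `u`
    have hflat : ∀ K : Set (EuclideanSpace ℝ (Fin 3)), IsCompact K →
        (0 : EuclideanSpace ℝ (Fin 3)) ∉ K → ∀ ε : ℝ, 0 < ε → ∀ᶠ j in atTop,
        ∀ᶠ δ in 𝓝[>] (0 : ℝ), eLpNorm (uncurry (conjZ θ (W j)) - uncurry (W j)) ⊤
          (volume.restrict (Ioo (-δ) 0 ×ˢ K)) ≤ ENNReal.ofReal ε := by
      intro K hK h0 ε hε
      filter_upwards [Hθ K hK h0 ε hε] with j hj
      filter_upwards [hj] with δ hδ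
      rwa [eLpNorm_scar_congr_ae (conjZ_ae_eq_slab θ (hWae j).symm) (hWae j).symm] at hδ
    have hS : SameScar (conjZ θ U) U :=
      sameScar_of_flat_defect (conjZ θ) (fun s x => rotZ θ (s (rotZ (-θ) x))) L W U σ σU hL
        (fun V hV => continuousOn_uncurry_conjZ θ hV)
        (fun V s hVs => rate_conjZ θ hVs)
        (fun s sl hs x hx =>
          ((rotZIso θ).continuous.tendsto _).comp (hs (rotZ (-θ) x) (rotZ_ne_zero (-θ) hx)))
        hWcont (fun j => (hσ j).1) hUrate hσlim hflat
    exact (sameScar_congr_ae (conjZ_ae_eq_slab θ hUae) hUae).1 hS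

end Summit.NavierStokesRegularity.NavierStokesRegularity.Theorems.SymmetricScarExists.ScarWindow

end
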